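import Mathlib
import Literature.NumberTheory.Transcendental.KZProductIdeal
import Literature.NumberTheory.Transcendental.KZLogCalculusProofs

/-!
# `TateLifting` (stmt-KontsevichZagierPeriods-9129), line `Sketch` — stub `stub_prodSplit`

PRODUCT SPLITTING in the Kontsevich–Zagier calculus. A representation `r = [ρ, h]` of dimension
`n + m` whose domain IS the product domain `σ × τ` of two representations `s = [σ, f]`
(dimension `n`) and `t = [τ, g]` (dimension `m`), and whose integrand agrees with `f ⊗ g` on it,
differs by relations from the Fubini product `[σ, f] · [τ, g]`: that product is the product
representation `[σ × τ, f ⊗ g] = s.prod t` (`KZ.of_mul_of`, domain `KZ.IntegralRep.prodDomain`,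
integrand `KZ.IntegralRep.prodFun` by `KZ.IntegralRep.prod_integrand_eq`), which has the same
domain as `r` and an integrand agreeing with `r.integrand` there, so the two differ by a relation
by congruence (integrand additivity against a zero representation,
`KZ.of_sub_of_mem_relations_of_eqOn`).

References: M. Kontsevich, D. Zagier, *Periods* (2001), §1.2 rule (1), §4.1 ("the product of
integrals is again an integral (Fubini)").
-/

noncomputable section

open MeasureTheory Set
open Literature.NumberTheory.Transcendental

namespace Summit.KontsevichZagierPeriods.InverseLandau

/-- **Product splitting** (stub `stub_prodSplit` of the lead's skeleton, the body of
`ProdSplit`): a representation `r` of dimension `n + m` whose domain is the product domain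
`σ × τ` of `s = [σ, f]` and `t = [τ, g]` and whose integrand agrees with `f ⊗ g` on it satisfies
`[r] − [σ, f] · [τ, g] ∈ KZ.relations`: the product `[σ, f] · [τ, g]` is the Fubini product
representation `s.prod t = [σ × τ, f ⊗ g]` (`KZ.of_mul_of`, `KZ.IntegralRep.prod_integrand_eq`),
congruent to `r` (`KZ.of_sub_of_mem_relations_of_eqOn`). [cite: KontsevichZagier2001, §4.1] -/
theorem tateLifting_prodSplit :
    ∀ (n m : ℕ) (r : KZ.IntegralRep (n + m)) (s : KZ.IntegralRep n) (t : KZ.IntegralRep m),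
      r.domain =
          {z | (fun i => z (Fin.castAdd m i)) ∈ s.domain ∧
            (fun j => z (Fin.natAdd n j)) ∈ t.domain} →
      Set.EqOn r.integrand
        (fun z =>
          s.integrand (fun i => z (Fin.castAdd m i)) * t.integrand (fun j => z (Fin.natAdd n j)))
        r.domain →
      KZ.of r - KZ.of s * KZ.of t ∈ KZ.relations := by
  intro n m r s t hdom hint
  rw [KZ.of_mul_of]
  refine KZ.of_sub_of_mem_relations_of_eqOn (by rw [hdom]; rfl) fun z hz => ?_
  rw [hint hz, KZ.IntegralRep.prod_integrand_eq, KZ.IntegralRep.prodFun_apply]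

end Summit.KontsevichZagierPeriods.InverseLandau

end
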